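import Summits.Langlands.Langlands.Theses.SteinbergWeightVelocity

/-!
# Sketch — crux WeightVelocity (stmt-Langlands-13450), round 1, ideator 2: first lemmas of the three idea cards

* `HostTransfer`      — cards `theta-coherent-host` and `siegel-eisenstein-host`: a HOST eigenvariety datum of ANY rank `N`
  over `K` whose leading gap jets for SOME pair of indices `(a, b)` (not necessarily consecutive) at `v` (1) lie in the
  `ℚ̄_p`-span of the characters of `c_i^⊥` of the Steinberg graded class of `ρ|Γ_{K_v}` (block-restricted CGS, hypothesis)
  and (2) span all continuous additive characters of `𝒪_vˣ` (host velocity, hypothesis) forces the piece to be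
  NON-CRYSTALLINE in Ding's sense (no non-zero unramified character in `c_i^⊥`).  Same linear algebra as the route's
  `MechanismToLocal`, but the family is not a `GL_n/K` family through `x(π)`: it is a rank-`N` host through a point
  carrying `ρ ⊕ ρ'` (theta lift: `N = 4`, pair `(σ'0, σ'2)`; Siegel–Eisenstein: `N = n+n`).
* `VelocityIffDualSelmer` — card `venkatesh-reciprocity`: the Mazur–Rubin/Poitou–Tate comparison skeleton: in an exact
  sequence `H¹_𝓛 →r 𝓛_v/𝓛'_v →δ (H¹_{𝓛'^⊥})^∨ →τ (H¹_{𝓛^⊥})^∨ → 0`, `r` is onto iff the two dual Selmer groups have the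
  same dimension.  (Pure linear algebra; the arithmetic is in identifying the terms.)
-/

namespace Summit.Langlands.Langlands.Cruxes.WeightVelocity.Ideator2

open scoped BigOperators
open Literature.NumberTheory.GaloisRepresentations Literature.NumberTheory.Automorphic IsDedekindDomain

/-- FIRST LEMMA of cards `theta-coherent-host` / `siegel-eisenstein-host` (glue, provable now by the linear algebra of
`MechanismToLocal`): host velocity for the pair `(a,b)` + block-CGS for that pair ⇒ the Steinberg graded piece `i` of
`ρ|Γ_{K_v}` is non-crystalline. -/
def HostTransfer : Prop :=
  ∀ (K : Type) [Field K] [NumberField K] (n N : ℕ) (p : ℕ) [Fact p.Prime]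
    (ρ : FramedGaloisRep K (PadicAlgCl p) n)
    (v : HeightOneSpectrum (NumberField.RingOfIntegers K)) (hv : ((p : ℕ) : NumberField.RingOfIntegers K) ∈ v.asIdeal)
    (𝔇 : ∀ (E₀ : IntermediateField ℚ_[p] (PadicAlgCl p)), FiniteDimensional ℚ_[p] E₀ →
      PhiGammaModuleRobba.{0, 0, 0} p (v.adicCompletion K) E₀),
    (∀ (E₀ : IntermediateField ℚ_[p] (PadicAlgCl p)) (hE₀ : FiniteDimensional ℚ_[p] E₀),
      (𝔇 E₀ hE₀).IsKPX (v.asIdeal.ramificationIdx ℤ * v.asIdeal.inertiaDeg ℤ)) →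
    ∀ (E₀ : IntermediateField ℚ_[p] (PadicAlgCl p)) (hE₀ : FiniteDimensional ℚ_[p] E₀)
      (rE : FramedGaloisRep (v.adicCompletion K) E₀ n),
      HasQlModel (ρ.toLocal v) E₀ rE →
    ∀ (U : Matrix.GeneralLinearGroup (Fin n) (𝔇 E₀ hE₀).R)
      (Tr : (((𝔇 E₀ hE₀).Drig rE).conj U).toPhiGammaModule.Triangulation n) (i : ℕ) (hi : i + 1 < n),
      Module.finrank E₀ ((𝔇 E₀ hE₀).H2 (Tr.ratioParam i hi).toModule) = 1 →
      Tr.IsNonSplitAt (𝔇 E₀ hE₀).gen i hi →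
      -- perfect special pairing (route item SpecialPairing, instance): some θ lies outside c_i^⊥
      (∃ θ : HomCont (v.adicCompletion K) E₀,
        (𝔇 E₀ hE₀).H1toH1 (PhiGammaModule.unit (𝔇 E₀ hE₀).ring) ((𝔇 E₀ hE₀).homToH1 θ) ∉
          (Tr.ratioParam i hi).toModule.cupOrthogonal (𝔇 E₀ hE₀).gen (Tr.gradedClass (𝔇 E₀ hE₀).gen i hi)) →
    -- THE HOST: any eigenvariety datum of rank N over K, a point x', a pair of indices (a, b) at v
    ∀ (S' : Set (HeightOneSpectrum (NumberField.RingOfIntegers K))) (Ev' : EigenvarietyResGLn K N p S') (x' : Ev'.Pt)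
      (a b : Fin N),
      -- (1) block-restricted Colmez–Greenberg–Stevens along every arc of the host (stub BlockCGS of the cards)
      (∀ (γ : Ev'.Fn →+* PowerSeries (PadicAlgCl p)) (hγ : γ ∈ Ev'.arcs x'),
        Ev'.leadingGapJet γ hγ.1 (⟨v, hv⟩ : PlacesOver K p) a b ∈
          Submodule.span (PadicAlgCl p) {f : (v.adicCompletion K)ˣ → PadicAlgCl p |
            ∃ θ : HomCont (v.adicCompletion K) E₀,
              (𝔇 E₀ hE₀).H1toH1 (PhiGammaModule.unit (𝔇 E₀ hE₀).ring) ((𝔇 E₀ hE₀).homToH1 θ) ∈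
                (Tr.ratioParam i hi).toModule.cupOrthogonal (𝔇 E₀ hE₀).gen (Tr.gradedClass (𝔇 E₀ hE₀).gen i hi) ∧
              f = fun z => (algebraMap E₀ (PadicAlgCl p)) ((θ : (v.adicCompletion K)ˣ → E₀) z)}) →
      -- (2) host velocity for the pair (a, b) (stub HostVelocity of the cards)
      (∀ (φ : (v.adicCompletionIntegers K)ˣ → PadicAlgCl p), Continuous φ → (∀ s t, φ (s * t) = φ s + φ t) →
        ∃ (r : ℕ) (γ : Fin r → (Ev'.Fn →+* PowerSeries (PadicAlgCl p))) (hγ : ∀ k, γ k ∈ Ev'.arcs x')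
          (c : Fin r → PadicAlgCl p), ∀ u : (v.adicCompletionIntegers K)ˣ,
            φ u = ∑ k : Fin r, c k * Ev'.leadingGapJet (γ k) (hγ k).1 (⟨v, hv⟩ : PlacesOver K p) a b
              (integerUnitsToUnits v u)) →
      -- CONCLUSION: the piece is non-crystalline (Ding: no non-zero unramified additive character lies in c_i^⊥)
      ∀ ψ : HomCont (v.adicCompletion K) E₀,
        (∀ u : (v.adicCompletion K)ˣ, Valued.v (u : v.adicCompletion K) = 1 → (ψ : (v.adicCompletion K)ˣ → E₀) u = 0) →
        ψ ≠ 0 →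
        (𝔇 E₀ hE₀).H1toH1 (PhiGammaModule.unit (𝔇 E₀ hE₀).ring) ((𝔇 E₀ hE₀).homToH1 ψ) ∉
          (Tr.ratioParam i hi).toModule.cupOrthogonal (𝔇 E₀ hE₀).gen (Tr.gradedClass (𝔇 E₀ hE₀).gen i hi)

/-- FIRST LEMMA of card `venkatesh-reciprocity` (glue, provable now): the Mazur–Rubin comparison of two nested Selmer
structures `𝓛' ≤ 𝓛` differing at one place. `HL = H¹_𝓛(K, ad ρ)`, `Q = 𝓛_v/𝓛'_v`, `D' = H¹_{𝓛'^⊥}(K, ad ρ(1))`,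
`D = H¹_{𝓛^⊥}(K, ad ρ(1))`; exactness `HL → Q → D'^∨ → D^∨ → 0` is Poitou–Tate (Mazur–Rubin, Kolyvagin systems,
Thm 2.3.4); conclusion: the gap-weight map is onto iff relaxing the dual condition at `v` creates no dual class. -/
def VelocityIffDualSelmer : Prop :=
  ∀ (E : Type) [Field E] (HL Q D' D : Type) [AddCommGroup HL] [Module E HL] [AddCommGroup Q] [Module E Q]
    [AddCommGroup D'] [Module E D'] [AddCommGroup D] [Module E D] [FiniteDimensional E D'] [FiniteDimensional E D]
    (r : HL →ₗ[E] Q) (δ : Q →ₗ[E] Module.Dual E D') (τ : Module.Dual E D' →ₗ[E] Module.Dual E D),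
    LinearMap.range r = LinearMap.ker δ → LinearMap.range δ = LinearMap.ker τ → Function.Surjective τ →
    (Function.Surjective r ↔ Module.finrank E D' = Module.finrank E D)

/-- The Bianchi instance of the reciprocity formula behind card `venkatesh-reciprocity` (pure linear algebra shadow):
one essential tangent vector with local gap components `(a, b)` at `(v, v̄)`, one dual class with local pairings
`(κv, κvb)` against the CGS lines, global reciprocity `a * κv + b * κvb = 0` and non-degeneracy ⇒ the direction is
`(κvb : -κv)`; in particular `a = 0 ↔ κvb = 0` ("velocity at v is decided at v̄"). -/
def BianchiDirection : Prop :=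
  ∀ (E : Type) [Field E] (a b κv κvb : E), a * κv + b * κvb = 0 → (a, b) ≠ (0, 0) → (κv, κvb) ≠ (0, 0) →
    (a = 0 ↔ κvb = 0)

theorem bianchiDirection_holds : BianchiDirection := by
  intro E _ a b κv κvb hrec hab hκ
  constructor
  · intro ha
    subst ha
    have hb : b ≠ 0 := by
      intro hb; exact hab (by simp [hb])
    have : b * κvb = 0 := by simpa using hrec
    rcases mul_eq_zero.mp this with h | h
    · exact absurd h hb
    · exact h
  · intro hk
    subst hk
    have hκv : κv ≠ 0 := by
      intro h; exact hκ (by simp [h])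
    have : a * κv = 0 := by simpa using hrec
    rcases mul_eq_zero.mp this with h | h
    · exact h
    · exact absurd h hκv

#check @HostTransfer
#check @VelocityIffDualSelmer

end Summit.Langlands.Langlands.Cruxes.WeightVelocity.Ideator2
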